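import Summits.KontsevichZagierPeriods.KontsevichZagierPeriods.Theorems.RootDecompWalshStrataCone4Band

/-!
# The cone specimen `x₃² > x₀² + x₁² + x₂²`, part 2/3: the Pythagorean chart

Route `RootDecompWalshStrata` (cell decomp-kz, lens 4, gen 11), support toward `QuadricSignKernel`
(item stmt-KontsevichZagierPeriods-25393), slice `d = 4`.  After part 1 the cone cell is
`[B³₊, q(1 − |u|)]`, an algebraic weight.  The POLYNOMIAL chart
`ψ(a, b, r) = (2ar, 2br, r(1 − a² − b²))` — the Pythagorean-quadruple parametrisation
`(2a, 2b, 1 − a² − b², 1 + a² + b²)` of the sphere, scaled by `r` — has `|ψ(a,b,r)| = r(1 + a² + b²)`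
(a polynomial!) and Jacobian `4r²(1 + a² + b²)`; it is injective on `{r > 0}` and maps the 3-cell
`Π = {(a,b) ∈ Q, 0 < r, r(1 + a² + b²) < 1}` (`Q` the quarter disc) onto `B³₊`, with inverse
`a = u₀/(u₂ + |u|)`, `b = u₁/(u₂ + |u|)`, `r = (u₂ + |u|)/2`.  Rule (2) gives
`[Π, q(1 − r(1+a²+b²))·4r²(1+a²+b²)] − [B³₊, q(1 − |u|)] ∈ KZ.relations`: the square root is gone.
0 sorry.  [KontsevichZagier2001 §1.2 rule (2)]
-/

noncomputable section

open Literature.NumberTheory.Transcendental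
open MeasureTheory Set
open MvPolynomial (aeval X C)
open Literature.ModelTheory.ExponentialFields (IsSemialgebraic isSemialgebraic_setOf_eval_pos
  isSemialgebraic_setOf_eval_lt continuous_aeval_real)
open Summit.KontsevichZagierPeriods.RootDecompWalshStrata.WalshSpanProof (isSemialgebraic_cubeSet
  isBounded_cubeSet cellRep cellRep_domain cellRep_integrand)
open Summit.KontsevichZagierPeriods.RootDecompWalshStrata.ConeSpecimen (cubeCell_subset_Icc)
open Summit.KontsevichZagierPeriods.RootDecompWalshStrata.Parab4 (ball3Poly aeval_ball3Poly b3Set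
  isSemialgebraic_b3Set b3Set_subset_Icc)

namespace Summit.KontsevichZagierPeriods.RootDecompWalshStrata.Cone4

/-! #### The source 3-cell `Π` and the source representation -/

/-- `1 − a² − b²` in the coordinates `(a, b, r)` of `ℝ³`. -/
def pyDiscPoly : MvPolynomial (Fin 3) ℚ := 1 - X 0 ^ 2 - X 1 ^ 2

/-- `1 − r(1 + a² + b²)`. -/
def pyCapPoly : MvPolynomial (Fin 3) ℚ := 1 - X 2 * (1 + X 0 ^ 2 + X 1 ^ 2)

/-- Evaluation of `pyDiscPoly`. [definition] -/
@[simp] theorem aeval_pyDiscPoly (w : Fin 3 → ℝ) : aeval w pyDiscPoly = 1 - w 0 ^ 2 - w 1 ^ 2 := by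
  simp [pyDiscPoly]

/-- Evaluation of `pyCapPoly`. [definition] -/
@[simp] theorem aeval_pyCapPoly (w : Fin 3 → ℝ) :
    aeval w pyCapPoly = 1 - w 2 * (1 + w 0 ^ 2 + w 1 ^ 2) := by
  simp [pyCapPoly]

/-- The source 3-cell `Π = (0,1)³ ∩ {a² + b² < 1} ∩ {r(1 + a² + b²) < 1}`. -/
def pySet : Set (Fin 3 → ℝ) :=
  {w | (∀ j, 0 < w j ∧ w j < 1) ∧ 0 < aeval w pyDiscPoly} ∩ {w | 0 < aeval w pyCapPoly}

/-- `Π` is `ℚ`-semialgebraic. [BCR1998 §2.1] -/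
theorem isSemialgebraic_pySet : IsSemialgebraic ℚ pySet :=
  (cellRep pyDiscPoly 0).isSemialgebraic_domain.inter (isSemialgebraic_setOf_eval_pos _)

/-- `Π ⊆ [0,1]³`. [folklore] -/
theorem pySet_subset_Icc : pySet ⊆ Icc 0 1 := fun _ hw => cubeCell_subset_Icc pyDiscPoly hw.1

/-- Membership in `Π`, in coordinates. [definition] -/
theorem mem_pySet {w : Fin 3 → ℝ} :
    w ∈ pySet ↔ ((0 < w 0 ∧ w 0 < 1) ∧ (0 < w 1 ∧ w 1 < 1) ∧ (0 < w 2 ∧ w 2 < 1)) ∧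
      0 < 1 - w 0 ^ 2 - w 1 ^ 2 ∧ 0 < 1 - w 2 * (1 + w 0 ^ 2 + w 1 ^ 2) := by
  simp only [pySet, mem_inter_iff, mem_setOf_eq, aeval_pyDiscPoly, aeval_pyCapPoly]
  exact ⟨fun ⟨⟨hu, hc⟩, hlt⟩ => ⟨⟨hu 0, hu 1, hu 2⟩, hc, hlt⟩, fun ⟨⟨h0, h1, h2⟩, hc, hlt⟩ =>
    ⟨⟨fun j => by fin_cases j <;> assumption, hc⟩, hlt⟩⟩

/-- The source weight `q(1 − r(1+a²+b²))·4r²(1+a²+b²)` is continuous on `ℝ³`. [folklore] -/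
theorem continuous_wPy (q : ℚ) : Continuous fun w : Fin 3 → ℝ =>
    (q : ℝ) * (1 - w 2 * (1 + w 0 ^ 2 + w 1 ^ 2)) * (4 * w 2 ^ 2 * (1 + w 0 ^ 2 + w 1 ^ 2)) := by
  fun_prop

/-- `[Π, q(1 − r(1+a²+b²))·4r²(1+a²+b²)]`: the source representation of the chart (a POLYNOMIAL
weight). [KontsevichZagier2001 §1.1] -/
def pyRep (q : ℚ) : KZ.IntegralRep 3 where
  domain := pySet
  integrand w := (q : ℝ) * (1 - w 2 * (1 + w 0 ^ 2 + w 1 ^ 2)) * (4 * w 2 ^ 2 * (1 + w 0 ^ 2 + w 1 ^ 2))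
  isSemialgebraic_domain := isSemialgebraic_pySet
  isSemialgebraicFunOn_integrand :=
    (isSemialgebraicFunOn_aeval isSemialgebraic_pySet
      (C q * (1 - X 2 * (1 + X 0 ^ 2 + X 1 ^ 2)) * (4 * X 2 ^ 2 * (1 + X 0 ^ 2 + X 1 ^ 2)))).congr
      fun w _ => by simp
  integrableOn :=
    ((continuous_wPy q).continuousOn.integrableOn_compact isCompact_Icc).mono_set pySet_subset_Icc

/-- The domain of the source representation. [definition] -/
@[simp] theorem pyRep_domain (q : ℚ) : (pyRep q).domain = pySet := rfl

/-- The integrand of the source representation. [definition] -/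
@[simp] theorem pyRep_integrand (q : ℚ) (w : Fin 3 → ℝ) : (pyRep q).integrand w =
    (q : ℝ) * (1 - w 2 * (1 + w 0 ^ 2 + w 1 ^ 2)) * (4 * w 2 ^ 2 * (1 + w 0 ^ 2 + w 1 ^ 2)) := rfl

/-! #### The Pythagorean chart `ψ(a, b, r) = (2ar, 2br, r(1 − a² − b²))` -/

/-- The chart as a polynomial map. -/
def psiPoly : Fin 3 → MvPolynomial (Fin 3) ℚ := ![2 * X 0 * X 2, 2 * X 1 * X 2, X 2 * (1 - X 0 ^ 2 - X 1 ^ 2)]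

/-- `ψ(a, b, r) = (2ar, 2br, r(1 − a² − b²))`. -/
def psi : (Fin 3 → ℝ) → (Fin 3 → ℝ) := fun w j => aeval w (psiPoly j)

/-- `ψ(w)₀ = 2 w₀ w₂`. [definition] -/
@[simp] theorem psi_zero (w : Fin 3 → ℝ) : psi w 0 = 2 * w 0 * w 2 := by simp [psi, psiPoly]

/-- `ψ(w)₁ = 2 w₁ w₂`. [definition] -/
@[simp] theorem psi_one (w : Fin 3 → ℝ) : psi w 1 = 2 * w 1 * w 2 := by simp [psi, psiPoly]

/-- `ψ(w)₂ = w₂(1 − w₀² − w₁²)`. [definition] -/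
@[simp] theorem psi_two (w : Fin 3 → ℝ) : psi w 2 = w 2 * (1 - w 0 ^ 2 - w 1 ^ 2) := by
  simp [psi, psiPoly]

/-- The Jacobian matrix of `ψ`. -/
def psiMat (w : Fin 3 → ℝ) : Matrix (Fin 3) (Fin 3) ℝ :=
  !![2 * w 2, 0, 2 * w 0; 0, 2 * w 2, 2 * w 1; -(2 * w 0 * w 2), -(2 * w 1 * w 2), 1 - w 0 ^ 2 - w 1 ^ 2]

/-- The derivative of `ψ` as a continuous linear map. -/
def psi' (w : Fin 3 → ℝ) : (Fin 3 → ℝ) →L[ℝ] (Fin 3 → ℝ) :=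
  LinearMap.toContinuousLinearMap (Matrix.toLin' (psiMat w))

/-- `ψ'(w)` acts by the Jacobian matrix. [calculus] -/
theorem psi'_apply (w v : Fin 3 → ℝ) (a : Fin 3) : psi' w v a = ∑ b, psiMat w a b * v b := by
  change Matrix.toLin' (psiMat w) v a = _
  rw [Matrix.toLin'_apply]
  rfl

/-- `det ψ'(a, b, r) = 4r²(1 + a² + b²)`. [calculus] -/
theorem psi'_det (w : Fin 3 → ℝ) : (psi' w).det = 4 * w 2 ^ 2 * (1 + w 0 ^ 2 + w 1 ^ 2) := by
  change LinearMap.det (Matrix.toLin' (psiMat w)) = _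
  rw [LinearMap.det_toLin', psiMat, Matrix.det_fin_three]
  simp
  ring

/-- `ψ` is differentiable with derivative `ψ'`. [calculus] -/
theorem hasFDerivAt_psi (w : Fin 3 → ℝ) : HasFDerivAt psi (psi' w) w := by
  have h0 : HasFDerivAt (fun z : Fin 3 → ℝ => psi z 0)
      ((ContinuousLinearMap.proj 0).comp (psi' w)) w := by
    have hf : (fun z : Fin 3 → ℝ => psi z 0) = fun z => 2 * z 0 * z 2 := funext psi_zero
    rw [hf]
    refine (((hasFDerivAt_apply 0 w).const_mul (2:ℝ)).mul (hasFDerivAt_apply 2 w)).congr_fderiv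
      (ContinuousLinearMap.ext fun v => ?_)
    simp [psi'_apply, psiMat, Fin.sum_univ_three]
    ring
  have h1 : HasFDerivAt (fun z : Fin 3 → ℝ => psi z 1)
      ((ContinuousLinearMap.proj 1).comp (psi' w)) w := by
    have hf : (fun z : Fin 3 → ℝ => psi z 1) = fun z => 2 * z 1 * z 2 := funext psi_one
    rw [hf]
    refine (((hasFDerivAt_apply 1 w).const_mul (2:ℝ)).mul (hasFDerivAt_apply 2 w)).congr_fderiv
      (ContinuousLinearMap.ext fun v => ?_)
    simp [psi'_apply, psiMat, Fin.sum_univ_three]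
    ring
  have h2 : HasFDerivAt (fun z : Fin 3 → ℝ => psi z 2)
      ((ContinuousLinearMap.proj 2).comp (psi' w)) w := by
    have hf : (fun z : Fin 3 → ℝ => psi z 2) = fun z => z 2 * (1 - z 0 * z 0 - z 1 * z 1) :=
      funext fun z => by rw [psi_two]; ring
    rw [hf]
    refine ((hasFDerivAt_apply 2 w).mul (((hasFDerivAt_const (1:ℝ) w).sub
      ((hasFDerivAt_apply 0 w).mul (hasFDerivAt_apply 0 w))).sub
      ((hasFDerivAt_apply 1 w).mul (hasFDerivAt_apply 1 w)))).congr_fderiv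
      (ContinuousLinearMap.ext fun v => ?_)
    simp [psi'_apply, psiMat, Fin.sum_univ_three]
    ring
  refine hasFDerivAt_pi'' fun a => ?_
  fin_cases a
  · exact h0
  · exact h1
  · exact h2

/-- `|ψ(a, b, r)|² = (r(1 + a² + b²))²`: the Pythagorean identity. [folklore] -/
theorem psi_normSq (w : Fin 3 → ℝ) :
    (2 * w 0 * w 2) ^ 2 + (2 * w 1 * w 2) ^ 2 + (w 2 * (1 - w 0 ^ 2 - w 1 ^ 2)) ^ 2 =
      (w 2 * (1 + w 0 ^ 2 + w 1 ^ 2)) ^ 2 := by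
  ring

/-- `ψ` is injective where `r > 0`. [calculus] -/
theorem injOn_psi : InjOn psi {w | 0 < w 2} := by
  intro x hx y hy hxy
  have hx2 : 0 < x 2 := hx
  have hy2 : 0 < y 2 := hy
  have e0 : 2 * x 0 * x 2 = 2 * y 0 * y 2 := by simpa using congrFun hxy 0
  have e1 : 2 * x 1 * x 2 = 2 * y 1 * y 2 := by simpa using congrFun hxy 1
  have e2 : x 2 * (1 - x 0 ^ 2 - x 1 ^ 2) = y 2 * (1 - y 0 ^ 2 - y 1 ^ 2) := by
    simpa using congrFun hxy 2
  have hN : (x 2 * (1 + x 0 ^ 2 + x 1 ^ 2)) ^ 2 = (y 2 * (1 + y 0 ^ 2 + y 1 ^ 2)) ^ 2 := by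
    rw [← psi_normSq, ← psi_normSq, e0, e1, e2]
  have hA : 0 < x 2 * (1 + x 0 ^ 2 + x 1 ^ 2) := by positivity
  have hB : 0 < y 2 * (1 + y 0 ^ 2 + y 1 ^ 2) := by positivity
  have hN' : x 2 * (1 + x 0 ^ 2 + x 1 ^ 2) = y 2 * (1 + y 0 ^ 2 + y 1 ^ 2) := by
    nlinarith [hN, hA, hB]
  have h2 : x 2 = y 2 := by linear_combination (hN' + e2) / 2
  have h0 : x 0 = y 0 := by
    have h : x 0 * (2 * x 2) = y 0 * (2 * x 2) := by linear_combination e0 - 2 * y 0 * h2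
    exact mul_right_cancel₀ (by positivity) h
  have h1 : x 1 = y 1 := by
    have h : x 1 * (2 * x 2) = y 1 * (2 * x 2) := by linear_combination e1 - 2 * y 1 * h2
    exact mul_right_cancel₀ (by positivity) h
  funext a
  fin_cases a
  · exact h0
  · exact h1
  · exact h2

/-- `ψ` maps `Π` onto `B³₊` (inverse `a = u₀/(u₂ + |u|)`, `b = u₁/(u₂ + |u|)`, `r = (u₂ + |u|)/2`).
[calculus] -/
theorem image_psi : psi '' pySet = b3Set := by
  ext u
  rw [mem_image, mem_b3Set]
  constructor
  · rintro ⟨w, hw, rfl⟩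
    rw [mem_pySet] at hw
    obtain ⟨⟨ha, hb, hr⟩, hdisc, hcap⟩ := hw
    have hD : 0 < 1 + w 0 ^ 2 + w 1 ^ 2 := by positivity
    have hrD : 0 < w 2 * (1 + w 0 ^ 2 + w 1 ^ 2) := mul_pos hr.1 hD
    simp only [psi_zero, psi_one, psi_two]
    refine ⟨⟨⟨mul_pos (mul_pos two_pos ha.1) hr.1, ?_⟩, ⟨mul_pos (mul_pos two_pos hb.1) hr.1, ?_⟩,
      ⟨mul_pos hr.1 hdisc, ?_⟩⟩, ?_⟩
    · nlinarith [sq_nonneg (1 - w 0), sq_nonneg (w 1), hr.1]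
    · nlinarith [sq_nonneg (1 - w 1), sq_nonneg (w 0), hr.1]
    · nlinarith [sq_nonneg (w 0), sq_nonneg (w 1), hr.1]
    · rw [show 1 - (2 * w 0 * w 2) ^ 2 - (2 * w 1 * w 2) ^ 2 - (w 2 * (1 - w 0 ^ 2 - w 1 ^ 2)) ^ 2 =
          1 - (w 2 * (1 + w 0 ^ 2 + w 1 ^ 2)) ^ 2 by ring]
      nlinarith [hrD, hcap]
  · rintro ⟨⟨h0, h1, h2⟩, hc⟩
    have hu : u ∈ b3Set := mem_b3Set.2 ⟨⟨h0, h1, h2⟩, hc⟩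
    have hρ0 : 0 < nrm u :=
      Real.sqrt_pos.2 (by nlinarith [pow_pos h0.1 2, sq_nonneg (u 1), sq_nonneg (u 2)])
    have hρ1 : nrm u < 1 := (nrm_lt_one hu).2
    have hρ2 : nrm u ^ 2 = u 0 ^ 2 + u 1 ^ 2 + u 2 ^ 2 := Real.sq_sqrt (by positivity)
    set ρ := nrm u with hρ_def
    set s := u 2 + ρ with hs_def
    have hs0 : 0 < s := add_pos h2.1 hρ0
    have hsne : s ≠ 0 := hs0.ne'
    have hkey : s ^ 2 + u 0 ^ 2 + u 1 ^ 2 = 2 * ρ * s := by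
      rw [hs_def]; linear_combination (-1:ℝ) * hρ2
    have hsu : s ^ 2 = s * u 2 + s * ρ := by rw [hs_def]; ring
    have hu0ρ : u 0 ≤ ρ := by nlinarith [hρ2, h0.1, hρ0, sq_nonneg (u 1), sq_nonneg (u 2)]
    have hu1ρ : u 1 ≤ ρ := by nlinarith [hρ2, h1.1, hρ0, sq_nonneg (u 0), sq_nonneg (u 2)]
    have hnum : s ^ 2 - u 0 ^ 2 - u 1 ^ 2 = 2 * s * u 2 := by linarith [hkey, hsu]
    have hdisc' : 1 - (u 0 / s) ^ 2 - (u 1 / s) ^ 2 = (s ^ 2 - u 0 ^ 2 - u 1 ^ 2) / s ^ 2 := by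
      field_simp
    have hcap' : s / 2 * (1 + (u 0 / s) ^ 2 + (u 1 / s) ^ 2) = ρ := by
      have e : s / 2 * (1 + (u 0 / s) ^ 2 + (u 1 / s) ^ 2) = (s ^ 2 + u 0 ^ 2 + u 1 ^ 2) / (2 * s) := by
        field_simp
      rw [e, hkey]
      field_simp
    refine ⟨![u 0 / s, u 1 / s, s / 2], ?_, ?_⟩
    · rw [mem_pySet]
      simp only [Matrix.cons_val_zero, Matrix.cons_val_one, Matrix.cons_val]
      refine ⟨⟨⟨div_pos h0.1 hs0, (div_lt_one hs0).2 (by linarith [h2.1])⟩,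
        ⟨div_pos h1.1 hs0, (div_lt_one hs0).2 (by linarith [h2.1])⟩,
        ⟨by positivity, by linarith [h2.2]⟩⟩, ?_, ?_⟩
      · rw [hdisc', hnum]
        exact div_pos (mul_pos (mul_pos two_pos hs0) h2.1) (pow_pos hs0 2)
      · rw [hcap']
        linarith
    · funext a
      fin_cases a
      · simp only [Fin.reduceFinMk, psi_zero, Matrix.cons_val_zero, Matrix.cons_val]
        field_simp
      · simp only [Fin.reduceFinMk, psi_one, Matrix.cons_val_one, Matrix.cons_val]
        field_simp
      · simp only [Fin.reduceFinMk, psi_two, Matrix.cons_val_zero, Matrix.cons_val_one, Matrix.cons_val]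
        rw [hdisc', hnum]
        field_simp

/-- **Move (2), the Pythagorean chart:**
`[Π, q(1 − r(1+a²+b²))·4r²(1+a²+b²)] − [B³₊, q(1 − |u|)] ∈ KZ.relations`
(`|det ψ'| = 4r²(1 + a² + b²)`, `|ψ| = r(1 + a² + b²)`). [KontsevichZagier2001 §1.2 rule (2)] -/
theorem of_pyRep_sub_of_b3NRep_mem_relations (q : ℚ) :
    KZ.of (pyRep q) - KZ.of (b3NRep q) ∈ KZ.relations := by
  refine KZ.changeOfVariablesRel_subset_relations
    ⟨3, pyRep q, b3NRep q, psi, psi', ?_,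
      fun w _ => (hasFDerivAt_psi w).hasFDerivWithinAt,
      injOn_psi.mono fun w hw => (mem_pySet.1 hw).1.2.2.1, ?_, fun w hw => ?_, rfl⟩
  · exact isSemialgebraicMapOn_aeval (pyRep q).isSemialgebraic_domain psiPoly
  · rw [b3NRep_domain, pyRep_domain, image_psi]
  · have h := mem_pySet.1 hw
    have hr : 0 < w 2 := h.1.2.2.1
    have hD : 0 < 1 + w 0 ^ 2 + w 1 ^ 2 := by positivity
    have hn : √((2 * w 0 * w 2) ^ 2 + (2 * w 1 * w 2) ^ 2 + (w 2 * (1 - w 0 ^ 2 - w 1 ^ 2)) ^ 2) =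
        w 2 * (1 + w 0 ^ 2 + w 1 ^ 2) := by
      rw [psi_normSq]
      exact Real.sqrt_sq (mul_pos hr hD).le
    rw [pyRep_integrand, b3NRep_integrand, psi'_det, abs_of_pos (by positivity), psi_zero, psi_one,
      psi_two, hn]

end Summit.KontsevichZagierPeriods.RootDecompWalshStrata.Cone4

end
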